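import Summits.HodgeConjecture.HodgeConjecture.Theorems.LinearSystemTorelliLocalTubeSpanTypedAssemblyVanishing

/-!
# Route LinearSystemTorelli — crux `LocalTubeSpan` (stmt-HodgeConjecture-2490): the colimit form along a NEIGHBOURHOOD BASIS, and the vacuity of the "all small open sets" hypothesis

Helper file (`--supports stmt-HodgeConjecture-2490`, line `Sketch` of the crux chain, cycle 6,
continuation lead c5; stub `stub_hasBasisGlue`).

REPAIR of the line's typed endpoint.  The cycle-4/5 glue
`localTubeSpan_mem_localKernel_of_balls` / `…_of_rat_balls(_one)` /
`…_vanishing_of_rat_balls(_one)` derives the colimit form of the c-free local Schnell statement at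
`t₀` (the typed candidate `LocalTubeSpanCFree`: a class undetected on the local subgroups of SOME
neighbourhood of `t₀` lies in `localKernel … t₀`) from the surrogate at the local subgroups of ALL
sufficiently small OPEN neighbourhoods `N' ⊆ N₀` of `t₀`; the `_one` forms moreover ask that
`ι⁻¹ N'` be path connected for ALL such `N'`.  That last hypothesis is UNSATISFIABLE in the geometric
situation (`localTubeSpan_not_forall_open_nhds_isPathConnected`: for a dense-range `ι` into a
Hausdorff `T` and a non-isolated `t₀`, the open neighbourhood `N' = (U₀ ∪ U₁) ∩ interior N₀` made of
two disjoint open pieces around `t₀` and around a second point `t₁ ∈ N₀` has disconnected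
`ι⁻¹ N'`), so the cycle-5 "final typed shape" is vacuous as stated; and the all-view-points form
quantifies over arbitrary small open `N'`, whose local subgroups (e.g. for `N'` = a tiny ball plus thin
tubes around loops) are not the local fundamental groups of the singularity and need not satisfy
cyclic detection at all (thin subgroups, `…ThinMu`).  What the proof of the colimit form actually
uses is the surrogate along ONE NEIGHBOURHOOD BASIS of `t₀` (Milnor balls, whose punctured balls
`B ∖ Δ` are path connected and carry THE local fundamental group):

* `localTubeSpan_mem_localKernel_of_hasBasis` — abstract local system `V`, any basis `(b i)_{p i}`
  of `𝓝 t₀` (Mathlib `Filter.HasBasis`), surrogate at every view point of every basic set ⇒ colimit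
  form at `t₀` (`mem_localKernel_iff_of_hasBasis` + monotonicity of undetectedness);
* `localTubeSpan_mem_localKernel_of_hasBasis_one` — the same from ONE view point per basic set
  when the basic sets have path-connected preimages (conjugate local subgroups,
  `localTubeSpan_localSubgroup_conj_of_joinedIn` + `localTubeSpan_surrogate_conj_iff`);
* `localTubeSpan_mem_localKernel_of_rat_hasBasis_one`,
  `localTubeSpan_mem_localKernel_vanishing_of_rat_hasBasis_one` — on the tree's hyperplane-section
  package (full carrier `D.V k`, and the VANISHING carrier given the Lefschetz splitting): `ℚ`-cyclic
  detection of the rational monodromy at one local subgroup per basic set ⇒ `LocalTubeSpanCFree` at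
  `t₀`.  This is the satisfiable final typed shape: hypothesis (G) of the line = a neighbourhood
  basis of `t₀` by sets with path-connected punctured preimage + the Picard–Lefschetz presentation of
  one local subgroup per basic set as a covered transvection configuration;
* `localTubeSpan_not_forall_open_nhds_isPathConnected` — the vacuity theorem above.

No named facts; no `sorry`.
-/

-- `Summit.HodgeConjecture.HodgeConjecture.Theorems` is the mandated namespace (single-conjunct summit:
-- Sub = Summit), which `linter.dupNamespace` flags on every declaration; the lakefile turns the
-- linter off tree-wide (weak option), restated here so stand-alone elaboration is warning-free too.
set_option linter.dupNamespace false

noncomputable section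

open CategoryTheory groupCohomology
open _root_.Topology Filter
open Literature.AlgebraicGeometry Literature.AlgebraicGeometry.HodgeTheory
open Literature.AlgebraicTopology.SingularHomology
open scoped Pointwise

namespace Summit.HodgeConjecture.HodgeConjecture.Theorems

universe u v

/-! ### The colimit form along a neighbourhood basis (abstract local system) -/

section Abstract

variable {k S : Type u} [CommRing k] [TopologicalSpace S] {T : Type v} [TopologicalSpace T]
  (ι : C(S, T)) (V : Motives.LocalSystem k S) (s : S)

/-- **Colimit form from the surrogate along a neighbourhood basis (all view points).**  Let
`(b i)_{p i}` be a basis of `𝓝 t₀`.  If at every view point of every basic set `b i` the surrogate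
`ker (evalCoinvOn A S') = H1resKer A S'` holds for the local subgroup `S'` (with `A = V_s` the
monodromy representation), then a class `ξ` undetected by Schnell's third map on the local subgroups
of SOME neighbourhood `N` of `t₀` lies in the local kernel at `t₀`: choose a basic `b i ⊆ N`, whose
local subgroups are smaller (`localSubgroup_mono`) hence still do not detect `ξ`
(`localTubeSpan_evalCoinvOn_eq_zero_of_le`), apply the surrogate there, and read off membership in
`localKernel` along the basis (`mem_localKernel_iff_of_hasBasis`).  Unlike the "all small open sets"
form `localTubeSpan_mem_localKernel_of_balls`, this hypothesis only concerns one chosen basis (e.g.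
Milnor balls). [cite: BrosnanFangNiePearlstein2009, §1 eq. (1)] -/
theorem localTubeSpan_mem_localKernel_of_hasBasis {ι' : Sort*} {p : ι' → Prop} {b : ι' → Set T}
    {t₀ : T} (hb : (𝓝 t₀).HasBasis p b)
    (hsur : ∀ i, p i → ∀ (s' : S) (hs' : ι s' ∈ b i) (γ : Path s' s),
      LinearMap.ker (evalCoinvOn (monodromyRepObj V s) (localSubgroup ι s (b i) hs' γ)) =
        H1resKer (monodromyRepObj V s) (localSubgroup ι s (b i) hs' γ))
    (ξ : groupCohomology.H1 (monodromyRepObj V s))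
    (hξ : ∃ N ∈ 𝓝 t₀, ∀ (s' : S) (hs' : ι s' ∈ N) (γ : Path s' s),
      evalCoinvOn (monodromyRepObj V s) (localSubgroup ι s N hs' γ) ξ = 0) :
    ξ ∈ localKernel ι V s t₀ := by
  obtain ⟨N, hN, hzero⟩ := hξ
  obtain ⟨i, hi, hiN⟩ := hb.mem_iff.1 hN
  refine (mem_localKernel_iff_of_hasBasis ι s V hb ξ).2 ⟨i, hi, ?_⟩
  rw [mem_localKernelOn_iff]
  intro s' hs' γ
  rw [← hsur i hi s' hs' γ, LinearMap.mem_ker]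
  exact localTubeSpan_evalCoinvOn_eq_zero_of_le (monodromyRepObj V s)
    (localSubgroup_mono ι s hiN hs' γ) (hzero s' (hiN hs') γ)

/-- **Colimit form from the surrogate at ONE view point per basic set.**  Let `(b i)_{p i}` be a
basis of `𝓝 t₀` whose basic sets have path-connected preimages `ι⁻¹ (b i)` (punctured Milnor balls
`B ∖ Δ`).  If for each basic set the surrogate holds at the local subgroup seen from ONE view point,
then it holds at every view point (the local subgroups at a path-connected piece are conjugate,
`localTubeSpan_localSubgroup_conj_of_joinedIn`, and the surrogate is conjugation invariant,
`localTubeSpan_surrogate_conj_iff`), and the colimit form at `t₀` follows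
(`localTubeSpan_mem_localKernel_of_hasBasis`). [cite: BrosnanFangNiePearlstein2009, §1 eq. (1)] -/
theorem localTubeSpan_mem_localKernel_of_hasBasis_one {ι' : Sort*} {p : ι' → Prop}
    {b : ι' → Set T} {t₀ : T} (hb : (𝓝 t₀).HasBasis p b)
    (hsur : ∀ i, p i → IsPathConnected (ι ⁻¹' b i) ∧
      ∃ (s' : S) (hs' : ι s' ∈ b i) (γ : Path s' s),
        LinearMap.ker (evalCoinvOn (monodromyRepObj V s) (localSubgroup ι s (b i) hs' γ)) =
          H1resKer (monodromyRepObj V s) (localSubgroup ι s (b i) hs' γ))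
    (ξ : groupCohomology.H1 (monodromyRepObj V s))
    (hξ : ∃ N ∈ 𝓝 t₀, ∀ (s' : S) (hs' : ι s' ∈ N) (γ : Path s' s),
      evalCoinvOn (monodromyRepObj V s) (localSubgroup ι s N hs' γ) ξ = 0) :
    ξ ∈ localKernel ι V s t₀ := by
  refine localTubeSpan_mem_localKernel_of_hasBasis ι V s hb (fun i hi s' hs' γ => ?_) ξ hξ
  obtain ⟨hpc, s₁, hs₁, γ₁, h₁⟩ := hsur i hi
  obtain ⟨g, hg⟩ := localTubeSpan_localSubgroup_conj_of_joinedIn ι s (b i) hs' hs₁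
    (hpc.joinedIn s' hs' s₁ hs₁) γ γ₁
  rw [hg, localTubeSpan_surrogate_conj_iff]
  exact h₁

/-! ### The "all small open neighbourhoods" hypothesis with path-connectedness is unsatisfiable -/

/-- **Vacuity of the cycle-5 hypothesis `hballs` (path-connected form).**  If `ι : S → T` has dense
range (the smooth-fibre locus `P ∖ Δ` is dense in `P(ℂ)`), `T` is Hausdorff and `t₀` is not an
isolated point of `T`, then it is FALSE that all sufficiently small open neighbourhoods `N'` of `t₀`
have path-connected `ι⁻¹ N'`: pick `t₁ ≠ t₀` in the interior of the given `N₀`, disjoint open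
`U₀ ∋ t₀`, `U₁ ∋ t₁`, and `N' = (U₀ ∩ interior N₀) ∪ (U₁ ∩ interior N₀)`; both pieces of `ι⁻¹ N'`
are open, disjoint and (by density) nonempty, so `ι⁻¹ N'` is not preconnected.  Consequently the
hypotheses of `localTubeSpan_mem_localKernel_of_rat_balls_one` and
`localTubeSpan_mem_localKernel_vanishing_of_rat_balls_one` can never be met in the intended
situation; the satisfiable replacement quantifies over a neighbourhood BASIS
(`localTubeSpan_mem_localKernel_of_hasBasis_one` and its `_rat_` forms below). [folklore] -/
theorem localTubeSpan_not_forall_open_nhds_isPathConnected [T2Space T] (hι : DenseRange ι)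
    (t₀ : T) [(𝓝[≠] t₀).NeBot] :
    ¬ ∃ N₀ ∈ 𝓝 t₀, ∀ N' ∈ 𝓝 t₀, N' ⊆ N₀ → IsOpen N' → IsPathConnected (ι ⁻¹' N') := by
  rintro ⟨N₀, hN₀, h⟩
  have hint : interior N₀ ∈ 𝓝 t₀ := interior_mem_nhds.2 hN₀
  -- a second point `t₁ ≠ t₀` in the interior of `N₀`
  obtain ⟨t₁, ht₁int, ht₁ne⟩ : ∃ t₁ ∈ interior N₀, t₁ ≠ t₀ := by
    obtain ⟨t₁, h1, h2⟩ :=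
      Filter.nonempty_of_mem (f := 𝓝[≠] t₀) (inter_mem_nhdsWithin {t₀}ᶜ hint)
    exact ⟨t₁, h2, h1⟩
  -- disjoint open neighbourhoods of `t₀` and `t₁`
  obtain ⟨U₀, U₁, hU₀, hU₁, h₀, h₁, hdisj⟩ := t2_separation ht₁ne.symm
  set N' : Set T := (U₀ ∩ interior N₀) ∪ (U₁ ∩ interior N₀) with hN'def
  have hN'open : IsOpen N' := (hU₀.inter isOpen_interior).union (hU₁.inter isOpen_interior)
  have hN'mem : N' ∈ 𝓝 t₀ :=
    hN'open.mem_nhds (Or.inl ⟨h₀, mem_interior_iff_mem_nhds.2 hN₀⟩)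
  have hN'sub : N' ⊆ N₀ := by
    rintro x (⟨-, hx⟩ | ⟨-, hx⟩) <;> exact interior_subset hx
  have hpc := h N' hN'mem hN'sub hN'open
  -- the two open pieces of `ι⁻¹ N'`
  have hA : IsOpen (ι ⁻¹' (U₀ ∩ interior N₀)) :=
    (hU₀.inter isOpen_interior).preimage ι.continuous
  have hB : IsOpen (ι ⁻¹' (U₁ ∩ interior N₀)) :=
    (hU₁.inter isOpen_interior).preimage ι.continuous
  obtain ⟨a₀, ha₀⟩ := hι.exists_mem_open (hU₀.inter isOpen_interior)
    ⟨t₀, h₀, mem_interior_iff_mem_nhds.2 hN₀⟩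
  obtain ⟨a₁, ha₁⟩ := hι.exists_mem_open (hU₁.inter isOpen_interior) ⟨t₁, h₁, ht₁int⟩
  have hcover : ι ⁻¹' N' ⊆ ι ⁻¹' (U₀ ∩ interior N₀) ∪ ι ⁻¹' (U₁ ∩ interior N₀) := by
    rw [← Set.preimage_union]
  obtain ⟨x, -, hx₀, hx₁⟩ := hpc.isConnected.isPreconnected _ _ hA hB hcover
    ⟨a₀, Or.inl ha₀, ha₀⟩ ⟨a₁, Or.inr ha₁, ha₁⟩
  exact Set.disjoint_left.1 hdisj hx₀.1 hx₁.1

end Abstract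

/-! ### On the tree's hyperplane-section package: `ℚ`-cyclic detection along a basis -/

section Rat

variable {𝒳 Sb : Motives.SchemeOver ℂ} {π : 𝒳 ⟶ Sb} {n : ℕ} {T : Type v} [TopologicalSpace T]

/-- **`LocalTubeSpanCFree` at `t₀` from `ℚ`-cyclic detection along a neighbourhood basis (full
carrier).**  For the direct-image local system `Rᵏ π_* ℂ|_U` of a smooth projective family, a base
point `s ∈ U`, a continuous `ι : U → T` and a basis `(b i)_{p i}` of `𝓝 t₀` whose basic sets have
path-connected `ι⁻¹ (b i)` and carry ONE view point at which Schnell's third map of the rational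
monodromy (`DirectImageLocalSystem.ratMonodromy`) restricted to the local subgroup is injective:
every class of `H¹(π₁(U, s), (Rᵏ π_* ℂ)_s)` undetected on the local subgroups of some neighbourhood of
`t₀` lies in `localKernel ι (D.V k) s t₀` (`localTubeSpan_ker_evalCoinvOn_eq_H1resKer_of_rat` +
`localTubeSpan_mem_localKernel_of_hasBasis_one`). [cite: Schnell2010, §7 Prop. 12 (local form)] -/
theorem localTubeSpan_mem_localKernel_of_rat_hasBasis_one (ι : C(smoothFiberLocus π n, T))
    (D : DirectImageLocalSystem π n) (k : ℕ) (s : smoothFiberLocus π n) {ι' : Sort*}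
    {p : ι' → Prop} {b : ι' → Set T} {t₀ : T} (hb : (𝓝 t₀).HasBasis p b)
    (hdet : ∀ i, p i → IsPathConnected (ι ⁻¹' b i) ∧
      ∃ (s' : smoothFiberLocus π n) (hs' : ι s' ∈ b i) (γ : Path s' s),
        Function.Injective (evalCoinv
          (Rep.res (localSubgroup ι s (b i) hs' γ).subtype (Rep.of (D.ratMonodromy k s)))))
    (ξ : groupCohomology.H1 (monodromyRepObj (D.V k) s))
    (hξ : ∃ N ∈ 𝓝 t₀, ∀ (s' : smoothFiberLocus π n) (hs' : ι s' ∈ N) (γ : Path s' s),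
      evalCoinvOn (monodromyRepObj (D.V k) s) (localSubgroup ι s N hs' γ) ξ = 0) :
    ξ ∈ localKernel ι (D.V k) s t₀ := by
  refine localTubeSpan_mem_localKernel_of_hasBasis_one ι (D.V k) s hb (fun i hi => ?_) ξ hξ
  obtain ⟨hpc, s', hs', γ, hinj⟩ := hdet i hi
  exact ⟨hpc, s', hs', γ, localTubeSpan_ker_evalCoinvOn_eq_H1resKer_of_rat D k s _ hinj⟩

variable {X : Motives.SchemeOver ℂ} {j : 𝒳 ⟶ X}

/-- **`LocalTubeSpanCFree` at `t₀` from `ℚ`-cyclic detection along a neighbourhood basis, on the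
VANISHING local system** — the satisfiable final typed shape of the line: Lefschetz splitting
`Hⁿ(X_s) = Hⁿ(X_s)_van ⊕ i^*Hⁿ(X)` (hypothesis `IsCompl`, discharged from hard Lefschetz by
`localTubeSpan_lefschetzSplitting` / `…HardLefschetzMember` when `[X_s] = c·[H]`) + a neighbourhood
basis of `t₀` by sets with path-connected punctured preimage + `ℚ`-cyclic detection of the rational
monodromy at ONE local subgroup per basic set ⇒ every class of `H¹(π₁(U, s), (V_van)_s)` undetected
near `t₀` lies in `localKernel ι (D.vanishingLocalSystem μ hX hb) s t₀`.
[cite: Schnell2010, §7 Prop. 12 (local form)] -/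
theorem localTubeSpan_mem_localKernel_vanishing_of_rat_hasBasis_one
    (ι : C(smoothFiberLocus π n, T)) (D : HyperplaneSectionLocalSystem π n j)
    (μ : OrientationFamily) {m b : ℕ} (hX : Motives.IsSmoothProjective m X)
    (hb : n + 2 * m = b + 2 * n) (s : smoothFiberLocus π n)
    (hcompl : IsCompl (vanishing π n j μ hX hb s)
      (LinearMap.range (complexBetti.map (Motives.fiberι π s.1 ≫ j) n).hom))
    {ι' : Sort*} {p : ι' → Prop} {bs : ι' → Set T} {t₀ : T} (hbs : (𝓝 t₀).HasBasis p bs)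
    (hdet : ∀ i, p i → IsPathConnected (ι ⁻¹' bs i) ∧
      ∃ (s' : smoothFiberLocus π n) (hs' : ι s' ∈ bs i) (γ : Path s' s),
        Function.Injective (evalCoinv (Rep.res (localSubgroup ι s (bs i) hs' γ).subtype
          (Rep.of (D.toDirectImageLocalSystem.ratMonodromy n s)))))
    (ξ : groupCohomology.H1 (monodromyRepObj (D.vanishingLocalSystem μ hX hb) s))
    (hξ : ∃ N ∈ 𝓝 t₀, ∀ (s' : smoothFiberLocus π n) (hs' : ι s' ∈ N) (γ : Path s' s),
      evalCoinvOn (monodromyRepObj (D.vanishingLocalSystem μ hX hb) s)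
        (localSubgroup ι s N hs' γ) ξ = 0) :
    ξ ∈ localKernel ι (D.vanishingLocalSystem μ hX hb) s t₀ := by
  refine localTubeSpan_mem_localKernel_of_hasBasis_one ι (D.vanishingLocalSystem μ hX hb) s hbs
    (fun i hi => ?_) ξ hξ
  obtain ⟨hpc, s', hs', γ, hinj⟩ := hdet i hi
  exact ⟨hpc, s', hs', γ,
    localTubeSpan_ker_evalCoinvOn_vanishing_eq_H1resKer_of_rat D μ hX hb s hcompl _ hinj⟩

end Rat

end Summit.HodgeConjecture.HodgeConjecture.Theorems

end
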